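import Summits.QuantumFields.BalabanUV.T4Continuum.Spine.NE4.BalabanPhiZoneRate
import Summits.QuantumFields.BalabanUV.T4Continuum.Spine.NE4.BalabanPhiAxisRate

/-!
# Spine/NE4/BalabanPhiZoneRateAxis — (R61)(ii) by (R60): the continuum symbol `φ_μ^{(∞)}` of the printed (1.84) IDENTIFIED on the axis, and King's exponent `n⁻²` is SHARP
# (`n²·(φ_μ^{(n)} − φ_μ^{(∞)})(q·e_ι) = a∕6` for every depth `n`)

Cell `pub-balaban-gaps` (YM blitz G2), seat `ne4`, generation 17 (unit `pub-balaban-gaps-ne4-g17`); record `HOME/ne/NE4.md` §5 (R61)(ii).  Companion of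
`Spine/NE4/BalabanPhiZoneRate` (the NE2 lineage's rate `|φ_μ^{(n)} − φ_μ^{(∞)}| ≤ a·C_φ·n⁻²` at every momentum, re-cut to this row's currencies) and of generation 16's
`Spine/NE4/BalabanPhiAxisRate` ((R60): `φ_μ^{(n)}(q·e_ι) = 1 + a((2 + cos q)∕(12 sin²(q∕2)) + 1∕(6n²))` for a transverse component on the axis).

HONEST FRAMING.  NE4 = `T4CouplingMatching.ScaleShiftRate` is NOT IN PRINT ([Balaban1987RG1] = CMP **109** (1987) p. 264) and NOT proved; nothing below is about Bałaban's
β-functions or theorems — it is about the PRINTED `U = 1` symbol (1.84) of [Balaban1984PropagatorsI] p. 31 (tree `B5Prop11Leaves.phiMu`) in the simplest corner (momentum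
along a lattice axis, transverse component).  CONTENT: `phiMuInf_axis_eq` — `φ_μ^{(∞)}(q·e_ι) = 1 + a(2 + cos q)∕(12 sin²(q∕2))` (`μ ≠ ι`, `sin(q∕2) ≠ 0`; the limit
of (R60)'s closed form); `phiMu_sub_phiMuInf_axis` — `φ_μ^{(n)} − φ_μ^{(∞)} = a∕(6n²)` EXACTLY at every depth; `sq_mul_phiMu_sub_phiMuInf_axis` — `n²·(φ^{(n)} − φ^{(∞)}) = a∕6`:
the exponent `2` of the NE2 lineage's `B5QGQ199Rate.phiMu_rate` (King's [King1986] (4.31) exponent) cannot be raised for (1.84), and its constant `C_φ = π²∕12 + 1∕3`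
is within the factor `6·C_φ ≈ 6.9` of the axis value `1∕6`; `abs_phiMu_pow_sub_phiMuInf_axis` — at the depths `L^k` the (AF-0r) shape of `BalabanPhiZoneRate.conv_phiMu_pow`
holds on the axis with EQUALITY, constant `|a|∕6`.  No status word moves (NE4 DEPENDENT; NE2 is the pub-balaban U1a lineage's row; spine 0∕9).  One finite T⁴;
NOT ℝ⁴, NOT infinite volume, NOT a mass gap, NOT Clay.
-/

noncomputable section

namespace Summit.QuantumFields.BalabanUV.T4Continuum.Spine.NE4

open Real Filter Topology
open Literature.MathematicalPhysics.QuantumFieldTheory.Balaban1983to89.B5Prop11Leaves (phiMu)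
open BalabanPhiAxis (axisMom phiMu_axis_eq)

namespace BalabanPhiZone

variable {d : ℕ}

/-! ## §4 By (R60): the continuum symbol IDENTIFIED on the axis, and King's exponent is sharp -/

section Axis

/-- **THE CONTINUUM SYMBOL ON THE AXIS, CLOSED FORM**: for a transverse component `μ ≠ ι` and `sin(q∕2) ≠ 0`, `φ_μ^{(∞)}(q·e_ι) = 1 + a·(2 + cos q)∕(12 sin²(q∕2))` — the limit of
(R60)'s `φ_μ^{(n)}(q·e_ι) = 1 + a((2 + cos q)∕(12 sin²(q∕2)) + 1∕(6n²))` (any `a`; no zone hypothesis needed). [folklore] -/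
theorem phiMuInf_axis_eq (a : ℝ) {ι μ : Fin d} (hμ : μ ≠ ι) {q : ℝ} (hq : Real.sin (q / 2) ≠ 0) :
    phiMuInf a μ (axisMom ι q) = 1 + a * ((2 + Real.cos q) / (12 * Real.sin (q / 2) ^ 2)) := by
  have hseq : ∀ n : ℕ, phiMuSeq a μ (axisMom ι q) n
      = 1 + a * ((2 + Real.cos q) / (12 * Real.sin (q / 2) ^ 2) + (6 * ((n : ℝ) + 1) ^ 2)⁻¹) := by
    intro n
    rw [phiMuSeq, phiMu_axis_eq (n := n + 1) (by omega) a hμ hq]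
    push_cast
    ring
  have h1 : Tendsto (fun n : ℕ => ((n : ℝ) + 1)) atTop atTop := tendsto_natCast_atTop_atTop.atTop_add tendsto_const_nhds
  have h2 : Tendsto (fun n : ℕ => 6 * ((n : ℝ) + 1) ^ 2) atTop atTop :=
    ((tendsto_pow_atTop two_ne_zero).comp h1).const_mul_atTop (by norm_num)
  have h0 : Tendsto (fun n : ℕ => (6 * ((n : ℝ) + 1) ^ 2)⁻¹) atTop (𝓝 0) := h2.inv_tendsto_atTop
  have hlim : Tendsto (phiMuSeq a μ (axisMom ι q)) atTop (𝓝 (1 + a * ((2 + Real.cos q) / (12 * Real.sin (q / 2) ^ 2) + 0))) := by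
    have := (((tendsto_const_nhds (x := (2 + Real.cos q) / (12 * Real.sin (q / 2) ^ 2))).add h0).const_mul a).const_add 1
    exact this.congr' (Eventually.of_forall fun n => (hseq n).symm)
  rw [add_zero] at hlim
  rw [phiMuInf, hlim.limUnder_eq]

/-- **EXACT DISTANCE TO THE CONTINUUM ON THE AXIS**: `φ_μ^{(n)}(q·e_ι) − φ_μ^{(∞)}(q·e_ι) = a∕(6n²)` for every depth `n ≥ 1` (`μ ≠ ι`, `sin(q∕2) ≠ 0`). [folklore] -/
theorem phiMu_sub_phiMuInf_axis {n : ℕ} [NeZero n] (hn : 1 ≤ n) (a : ℝ) {ι μ : Fin d} (hμ : μ ≠ ι) {q : ℝ} (hq : Real.sin (q / 2) ≠ 0) :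
    phiMu n a μ (axisMom ι q) - phiMuInf a μ (axisMom ι q) = a / (6 * (n : ℝ) ^ 2) := by
  rw [phiMu_axis_eq hn a hμ hq, phiMuInf_axis_eq a hμ hq]
  ring

/-- **KING's EXPONENT IS SHARP FOR (1.84)**: `n²·(φ_μ^{(n)} − φ_μ^{(∞)})(q·e_ι) = a∕6` for EVERY `n ≥ 1` — no `o(n⁻²)`: the exponent `2` of `B5QGQ199Rate.phiMu_rate` ∕ §2 cannot be raised, and
its constant `C_φ = π²∕12 + 1∕3` (`abs_phiMu_sub_phiMuInf_le`) sits within the factor `6·C_φ` of the value `1∕6` attained here (`μ ≠ ι`, `sin(q∕2) ≠ 0`). [folklore] -/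
theorem sq_mul_phiMu_sub_phiMuInf_axis {n : ℕ} [NeZero n] (hn : 1 ≤ n) (a : ℝ) {ι μ : Fin d} (hμ : μ ≠ ι) {q : ℝ} (hq : Real.sin (q / 2) ≠ 0) :
    (n : ℝ) ^ 2 * (phiMu n a μ (axisMom ι q) - phiMuInf a μ (axisMom ι q)) = a / 6 := by
  have hn0 : (n : ℝ) ≠ 0 := by exact_mod_cast (by omega : n ≠ 0)
  rw [phiMu_sub_phiMuInf_axis hn a hμ hq]
  field_simp

/-- **AT THE DEPTHS `L^k` ON THE AXIS THE (AF-0r) SHAPE HOLDS WITH EQUALITY**: `|φ_μ^{(L^k)}(q·e_ι) − φ_μ^{(∞)}(q·e_ι)| = (|a|∕6)·(L⁻²)^k` (`1 ≤ L`, `μ ≠ ι`, `sin(q∕2) ≠ 0`) — to be set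
against §3's bound `a·C_φ·(L⁻²)^k` at every momentum. [folklore] -/
theorem abs_phiMu_pow_sub_phiMuInf_axis {L : ℕ} [NeZero L] (hL : 1 ≤ L) (k : ℕ) (a : ℝ) {ι μ : Fin d} (hμ : μ ≠ ι) {q : ℝ} (hq : Real.sin (q / 2) ≠ 0) :
    |phiMu (L ^ k) a μ (axisMom ι q) - phiMuInf a μ (axisMom ι q)| = |a| / 6 * ((L : ℝ)⁻¹ ^ 2) ^ k := by
  rw [phiMu_sub_phiMuInf_axis (Nat.one_le_pow k L hL) a hμ hq]
  have hpow : ((L : ℝ)⁻¹ ^ 2) ^ k = ((((L ^ k : ℕ) : ℝ)) ^ 2)⁻¹ := by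
    push_cast
    rw [← pow_mul, ← pow_mul, mul_comm 2 k, inv_pow]
  rw [hpow, abs_div, abs_of_pos (by positivity : (0 : ℝ) < 6 * (((L ^ k : ℕ) : ℝ)) ^ 2)]
  push_cast
  ring

end Axis

end BalabanPhiZone

end Summit.QuantumFields.BalabanUV.T4Continuum.Spine.NE4
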